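import Summits.SmoothPoincare4.SmoothPoincare4.Theorems.ConvexBisectionAcyclicBisectionExistsBeltSlideFraming
import Summits.SmoothPoincare4.SmoothPoincare4.Theorems.ConvexBisectionAcyclicBisectionExistsDualHandleSwap
import Literature.Geometry.Symplectic.TwoHandleIsotopyFraming
import Literature.Topology.FourManifolds.CorkDecompositionSplittingProof
import Literature.Topology.FourManifolds.ClosedBallRadialCoordinate
import HarnessLib

/-!
# The framed `r`-longitude of an attaching circle, I: model vectors and the longitude knot
(node T3c-1 `node_belt_isotopic_pushoff` of the sub-goal T3 of stub `stub_steinRealisation` (NF6), line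
`modp-braid-orbits`, crux `ConvexBisection.AcyclicBisectionExists`, item stmt-SmoothPoincare4-10508;
wave 3, worker Z5, lead c5; stage (3a) "framing clean-up" of V6-REPORT §2)

After the slide of the belt circle (`helper_belt_slide`, `helper_belt_slideFramingVector`) the framed
belt knot of handle `i` is, on the base side, the `h̄ᵢ`-image of the `r`-longitude
`y(θ) = (√(1-r²) u(θ), r θ) ∈ T` (`tubeLongitudePt b r θ`, `u = (θ₀, σ θ₁)`, `σ = slideSign b`) with the
framing `dh̄ᵢ (Dι⁻¹ W(θ))`, `W = frameW`.  This file supplies the model-side vocabulary used to clean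
that framing up:

* §1 the vectors `V = longVelVec` (velocity of the longitude), `X_θ = radVec` (tube normal),
  `X_{iθ} = angVec` (fibre-angular direction), `X_{θ²} = twistVec = θ₀ X_θ + θ₁ X_{iθ}` (tube-normal
  framing with ONE extra twist) and the transversality of every `a θ₀ X_θ + b θ₁ X_{iθ} + λ V`
  (`a, b > 0`) to `V` (`lincomb_ne_smul_longVelVec`; the sequel shows `W ≡ c θ₀ X_θ + (θ₁/c) X_{iθ} mod V`);
* §2 the longitude as an isometric image of the model circle (`longIso`, `coe_coe_tubeLongitudePt_eq`),
  hence a smooth embedding `𝕊¹ → T` (`isSmoothEmbedding_tubeLongitudePt`); its `h̄`-image is a knot in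
  `∂W` (`isBoundaryKnot_longitude`) with velocity `dh̄ (Dι⁻¹ (2π V))` (`knotVelocity_longitude`);
* §3 `mfderiv_handleAttachingMap_apply_zero`: `dh̄ (Dι⁻¹ X)` is tangent to `∂W` for `X ⊥ y`, `‖y‖ = 1`;
* §4 registered helper `helper_belt_longitudeKnot`.

Everything is proved; no named facts.

## References
* A. A. Kosinski, *Differential Manifolds*, Academic Press (1993), VI §6. [Kosinski1993]
* R. C. Kirby, *The Topology of 4-Manifolds*, LNM 1374 (1989), Ch. I §2 (framings). [Kirby1989]
* R. E. Gompf, *Handlebody construction of Stein surfaces*, Ann. of Math. 148 (1998), §1. [Gompf1998]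
-/

noncomputable section

-- the prescribed namespace `Summit.<P>.<Sub>.…` duplicates `SmoothPoincare4` (P = Sub)
set_option linter.dupNamespace false

open scoped Manifold ContDiff Topology RealInnerProductSpace
open Set Function Metric Real

namespace Summit.SmoothPoincare4.SmoothPoincare4.Theorems.AcyclicBisectionExists.ModpBraidOrbits

open Literature.Topology.FourManifolds Literature.Topology.FourManifolds.HandleAttachingMap
  Literature.Geometry.Symplectic


/-! ### §1 Model vectors along the `r`-longitude and the decomposition of `W` -/

/-- The velocity direction `V = (−c θ₁, σ c θ₀, −r θ₁, r θ₀)` of the `r`-longitude (`c = √(1-r²)`).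
[folklore] -/
def longVelVec (σ' r θ₀ θ₁ : ℝ) : Fin 4 → ℝ :=
  ![-(Real.sqrt (1 - r ^ 2) * θ₁), σ' * Real.sqrt (1 - r ^ 2) * θ₀, -(r * θ₁), r * θ₀]

/-- The outward tube-normal direction `X_θ = (−(r/c) u, θ)` at the `r`-longitude point. [folklore] -/
def radVec (σ' r θ₀ θ₁ : ℝ) : Fin 4 → ℝ :=
  ![-(r / Real.sqrt (1 - r ^ 2) * θ₀), -(r / Real.sqrt (1 - r ^ 2) * σ' * θ₁), θ₀, θ₁]

/-- The fibre-angular direction `X_{iθ} = (0, iθ)`. [folklore] -/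
def angVec (θ₀ θ₁ : ℝ) : Fin 4 → ℝ := ![0, 0, -θ₁, θ₀]

/-- **The one-twist framing vector** `X_{θ²} = θ₀ X_θ + θ₁ X_{iθ} = (−(r/c) θ₀ u, θ²)`: the fibre
derivative of the sphere part of the tube in the direction `θ² ∈ ℂ`. [folklore] -/
def twistVec (σ' r θ₀ θ₁ : ℝ) : Fin 4 → ℝ :=
  ![-(r / Real.sqrt (1 - r ^ 2) * θ₀ ^ 2), -(r / Real.sqrt (1 - r ^ 2) * σ' * θ₀ * θ₁),
    θ₀ ^ 2 - θ₁ ^ 2, 2 * θ₀ * θ₁]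

/-- `X_{θ²} = θ₀ X_θ + θ₁ X_{iθ}`. [folklore] -/
theorem twistVec_eq_lincomb (σ' r θ₀ θ₁ : ℝ) :
    twistVec σ' r θ₀ θ₁ = θ₀ • radVec σ' r θ₀ θ₁ + θ₁ • angVec θ₀ θ₁ := by
  ext i; fin_cases i <;> simp [twistVec, radVec, angVec] <;> ring

/-- **Transversality**: for `a, b > 0` no combination `a θ₀ X_θ + b θ₁ X_{iθ} + λ V` is a multiple of
the velocity `V` (`0 < r < 1`, `θ₀² + θ₁² = 1`, `σ'² = 1`). [folklore] -/
theorem lincomb_ne_smul_longVelVec {σ' r θ₀ θ₁ : ℝ} (hσ : σ' ^ 2 = 1) (h0 : 0 < r) (h1 : r < 1)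
    (hθ : θ₀ ^ 2 + θ₁ ^ 2 = 1) {a b : ℝ} (ha : 0 < a) (hb : 0 < b) (lam μ : ℝ) :
    (a * θ₀) • radVec σ' r θ₀ θ₁ + (b * θ₁) • angVec θ₀ θ₁ + lam • longVelVec σ' r θ₀ θ₁ ≠
      μ • longVelVec σ' r θ₀ θ₁ := by
  set c := Real.sqrt (1 - r ^ 2) with hc
  have hc0 : 0 < c := Real.sqrt_pos.2 (by nlinarith)
  intro h
  have e0 := congr_fun h 0
  have e1 := congr_fun h 1
  have e2 := congr_fun h 2
  simp [radVec, angVec, longVelVec, ← hc] at e0 e1 e2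
  -- `κ = μ - λ` vanishes: `θ₁ · e0 + σ' θ₀ · e1`
  have hκ : c * (μ - lam) = 0 := by
    have h3 : a * r * θ₀ ^ 2 = c ^ 2 * θ₁ * (μ - lam) := by
      field_simp at e0; linear_combination -e0
    have h4 : -(a * r * θ₀ * θ₁) * σ' = c ^ 2 * θ₀ * (μ - lam) * σ' := by
      field_simp at e1; linear_combination e1
    have h5 : -(a * r * θ₀ * θ₁) = c ^ 2 * θ₀ * (μ - lam) := by
      have := congrArg (· * σ') h4
      simp only [mul_assoc, ← sq, hσ, mul_one] at this
      linear_combination this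
    have h6 : c ^ 2 * (μ - lam) = 0 := by
      linear_combination (-θ₁) * h3 + (-θ₀) * h5 + (-(c ^ 2 * (μ - lam))) * hθ
    have : c * (c * (μ - lam)) = 0 := by linear_combination h6
    simpa [hc0.ne'] using this
  have hκ' : μ - lam = 0 := by
    rcases mul_eq_zero.1 hκ with h' | h'
    · exact absurd h' hc0.ne'
    · exact h'
  have hθ₀ : θ₀ = 0 := by
    have h3 : a * r * θ₀ ^ 2 = c ^ 2 * θ₁ * (μ - lam) := by
      field_simp at e0; linear_combination -e0
    rw [hκ', mul_zero] at h3
    have : θ₀ ^ 2 = 0 := by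
      rcases mul_eq_zero.1 h3 with h' | h'
      · exact absurd h' (by positivity)
      · exact h'
    exact pow_eq_zero_iff (n := 2) (by norm_num) |>.1 this
  have hθ₁ : θ₁ = 0 := by
    have h7 : a * θ₀ * θ₀ - b * θ₁ * θ₁ = -(r * θ₁) * (μ - lam) := by linear_combination e2
    rw [hκ', hθ₀] at h7
    have : b * θ₁ ^ 2 = 0 := by linear_combination -h7
    rcases mul_eq_zero.1 this with h' | h'
    · exact absurd h' hb.ne'
    · exact pow_eq_zero_iff (n := 2) (by norm_num) |>.1 h'
  rw [hθ₀, hθ₁] at hθ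
  norm_num at hθ


/-! ### §2 The `r`-longitude as a knot in `∂W` -/

/-- The isometry `A_ρ = R_{arccos ρ} ∘ σ` of `ℝ⁴` (block swap, then isoclinic rotation) carrying the
model circle `(θ, 0)` to the `ρ`-longitude `(√(1-ρ²) u(θ), ρ θ)`. [folklore] -/
def longIso (b : Bool) (ρ : ℝ) : EuclideanSpace ℝ (Fin 4) ≃ₗᵢ[ℝ] EuclideanSpace ℝ (Fin 4) :=
  swapIso.trans (slideIso b (Real.arccos ρ))

/-- `A_ρ u = R_{arccos ρ} (σ u)`. [folklore] -/
theorem longIso_apply (b : Bool) (ρ : ℝ) (u : EuclideanSpace ℝ (Fin 4)) :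
    longIso b ρ u = slideFun b (Real.arccos ρ) (swapIso u) := rfl

/-- `A_ρ (θ, 0)` is the vector of the `ρ`-longitude point (`0 ≤ ρ ≤ 1`). [folklore] -/
theorem longIso_corePt (b : Bool) {ρ : ℝ} (h0 : 0 ≤ ρ) (h1 : ρ ≤ 1)
    (θ : sphere (0 : EuclideanSpace ℝ (Fin 2)) 1) :
    longIso b ρ (corePt θ) = tubeLongitudeVec b ρ θ := by
  have hc : Real.cos (Real.arccos ρ) = ρ := Real.cos_arccos (by linarith) h1
  have hs : Real.sin (Real.arccos ρ) = Real.sqrt (1 - ρ ^ 2) := Real.sin_arccos ρ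
  ext i
  fin_cases i <;> simp [longIso_apply, tubeLongitudeVec, corePt, hc, hs]

/-- The `ρ`-longitude point of `T`, read in `D⁴`, is the isometric image `A_ρ` of the model circle point
(`0 ≤ ρ < 1`). [folklore] -/
theorem coe_tubeLongitudePt_eq (b : Bool) {ρ : ℝ} (h0 : 0 ≤ ρ) (h1 : ρ < 1)
    (θ : sphere (0 : EuclideanSpace ℝ (Fin 2)) 1) :
    ((tubeLongitudePt b ρ θ : ↥(handleTube 3 2)) : closedBall (0 : EuclideanSpace ℝ (Fin 4)) 1) =
      closedBallCongr (longIso b ρ) ((coreTubePt θ : ↥(handleTube 3 2)) :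
        closedBall (0 : EuclideanSpace ℝ (Fin 4)) 1) := by
  apply Subtype.ext
  rw [coe_coe_tubeLongitudePt b (by nlinarith) θ, coe_closedBallCongr, coe_coe_coreTubePt,
    longIso_corePt b h0 h1.le]

/-- **The `ρ`-longitude `θ ↦ (√(1-ρ²) u(θ), ρ θ)` is a smooth embedding `𝕊¹ → T`** (an isometric image of
the model circle, `0 ≤ ρ < 1`). [folklore] -/
theorem isSmoothEmbedding_tubeLongitudePt (b : Bool) {ρ : ℝ} (h0 : 0 ≤ ρ) (h1 : ρ < 1) :
    Manifold.IsSmoothEmbedding (𝓡 1) (𝓡∂ 4) ∞ (tubeLongitudePt b ρ) := by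
  have h := isSmoothEmbedding_coe_coreTubePt.diffeomorph_comp (closedBallCongr (longIso b ρ))
  have e : (fun θ : sphere (0 : EuclideanSpace ℝ (Fin 2)) 1 =>
      ((tubeLongitudePt b ρ θ : ↥(handleTube 3 2)) : closedBall (0 : EuclideanSpace ℝ (Fin 4)) 1)) =
      closedBallCongr (longIso b ρ) ∘ fun θ : sphere (0 : EuclideanSpace ℝ (Fin 2)) 1 =>
        ((coreTubePt θ : ↥(handleTube 3 2)) : closedBall (0 : EuclideanSpace ℝ (Fin 4)) 1) :=
    funext fun θ => coe_tubeLongitudePt_eq b h0 h1 θ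
  have h' : Manifold.IsSmoothEmbedding (𝓡 1) (𝓡∂ 4) ∞ fun θ : sphere (0 : EuclideanSpace ℝ (Fin 2)) 1 =>
      ((tubeLongitudePt b ρ θ : ↥(handleTube 3 2)) : closedBall (0 : EuclideanSpace ℝ (Fin 4)) 1) := by
    rw [e]; exact h
  exact h'.codRestrict_opens (handleTube 3 2) fun θ => (tubeLongitudePt b ρ θ).2

/-- The `ρ`-longitude is smooth into `T`. [folklore] -/
theorem contMDiff_tubeLongitudePt (b : Bool) {ρ : ℝ} (h0 : 0 ≤ ρ) (h1 : ρ < 1) :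
    ContMDiff (𝓡 1) (𝓡∂ 4) ∞ (tubeLongitudePt b ρ) :=
  (isSmoothEmbedding_tubeLongitudePt b h0 h1).contMDiff

/-- **The velocity of the `ρ`-longitude, read in `ℝ⁴`, is `A_ρ` of the model velocity.** [folklore] -/
theorem hasDerivAt_coe_coe_tubeLongitudePt_circlePt (b : Bool) {ρ : ℝ} (h0 : 0 ≤ ρ) (h1 : ρ < 1) (t : ℝ) :
    HasDerivAt (fun s : ℝ => (((tubeLongitudePt b ρ (circlePt s) : ↥(handleTube 3 2)) :
      closedBall (0 : EuclideanSpace ℝ (Fin 4)) 1) : EuclideanSpace ℝ (Fin 4)))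
      (longIso b ρ (coreVelocityAmb t)) t := by
  have e : (fun s : ℝ => (((tubeLongitudePt b ρ (circlePt s) : ↥(handleTube 3 2)) :
      closedBall (0 : EuclideanSpace ℝ (Fin 4)) 1) : EuclideanSpace ℝ (Fin 4))) =
      fun s => longIso b ρ (corePt (circlePt s)) := by
    funext s
    rw [coe_coe_tubeLongitudePt b (by nlinarith) (circlePt s), ← longIso_corePt b h0 h1.le]
  rw [e]
  exact (longIso b ρ).toContinuousLinearEquiv.toContinuousLinearMap.hasFDerivAt.comp_hasDerivAt t
    (hasDerivAt_corePt_circlePt t)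

/-- `A_ρ` of the model velocity is `2π V`. [folklore] -/
theorem longIso_coreVelocityAmb (b : Bool) {ρ : ℝ} (h0 : 0 ≤ ρ) (h1 : ρ ≤ 1) (t : ℝ) :
    longIso b ρ (coreVelocityAmb t) = (2 * Real.pi) • WithLp.toLp 2 (longVelVec (slideSign b) ρ
      (((circlePt t : sphere (0 : EuclideanSpace ℝ (Fin 2)) 1) : EuclideanSpace ℝ (Fin 2)) 0)
      (((circlePt t : sphere (0 : EuclideanSpace ℝ (Fin 2)) 1) : EuclideanSpace ℝ (Fin 2)) 1)) := by
  have hc : Real.cos (Real.arccos ρ) = ρ := Real.cos_arccos (by linarith) h1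
  have hs : Real.sin (Real.arccos ρ) = Real.sqrt (1 - ρ ^ 2) := Real.sin_arccos ρ
  ext i
  fin_cases i <;> simp [longIso_apply, coreVelocityAmb, lamPlaneLin, longVelVec, hc, hs] <;> ring

/-- **The chart velocity of the `ρ`-longitude is `Dι⁻¹ (2π V)`** (`Dι = closedBallCoeDeriv`). [folklore] -/
theorem mfderiv_tubeLongitudePt_circlePt (b : Bool) {ρ : ℝ} (h0 : 0 ≤ ρ) (h1 : ρ < 1) (t : ℝ) :
    mfderiv 𝓘(ℝ, ℝ) (𝓡∂ 4) (tubeLongitudePt b ρ ∘ circlePt) t (1 : ℝ) =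
      (closedBallCoeDeriv ((tubeLongitudePt b ρ (circlePt t) : ↥(handleTube 3 2)) :
        closedBall (0 : EuclideanSpace ℝ (Fin 4)) 1)).symm
        ((2 * Real.pi) • WithLp.toLp 2 (longVelVec (slideSign b) ρ
          (((circlePt t : sphere (0 : EuclideanSpace ℝ (Fin 2)) 1) : EuclideanSpace ℝ (Fin 2)) 0)
          (((circlePt t : sphere (0 : EuclideanSpace ℝ (Fin 2)) 1) : EuclideanSpace ℝ (Fin 2)) 1))) := by
  set pt : ↥(handleTube 3 2) := tubeLongitudePt b ρ (circlePt t) with hpt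
  have hc : MDifferentiableAt 𝓘(ℝ, ℝ) (𝓡∂ 4) (tubeLongitudePt b ρ ∘ circlePt) t :=
    ((contMDiff_tubeLongitudePt b h0 h1 _).comp t contMDiff_circlePt.contMDiffAt).mdifferentiableAt (by simp)
  have hval : HasMFDerivAt (𝓡∂ 4) 𝓘(ℝ, EuclideanSpace ℝ (Fin 4))
      (fun y : ↥(handleTube 3 2) => ((y : closedBall (0 : EuclideanSpace ℝ (Fin 4)) 1) : EuclideanSpace ℝ (Fin 4)))
      pt (closedBallCoeDeriv (pt : closedBall (0 : EuclideanSpace ℝ (Fin 4)) 1) :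
        EuclideanSpace ℝ (Fin 4) →L[ℝ] EuclideanSpace ℝ (Fin 4)) :=
    hasMFDerivAt_restrict_opens (handleTube 3 2) (hasMFDerivAt_coe_closedBall _)
  have h2 := hval.comp t hc.hasMFDerivAt
  have h1' : HasMFDerivAt 𝓘(ℝ, ℝ) 𝓘(ℝ, EuclideanSpace ℝ (Fin 4))
      ((fun y : ↥(handleTube 3 2) => ((y : closedBall (0 : EuclideanSpace ℝ (Fin 4)) 1) :
        EuclideanSpace ℝ (Fin 4))) ∘ (tubeLongitudePt b ρ ∘ circlePt)) t
      (ContinuousLinearMap.smulRight (1 : ℝ →L[ℝ] ℝ) (longIso b ρ (coreVelocityAmb t))) :=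
    (hasDerivAt_coe_coe_tubeLongitudePt_circlePt b h0 h1 t).hasFDerivAt.hasMFDerivAt
  have h3 := h2.mfderiv.symm.trans h1'.mfderiv
  have h4 : closedBallCoeDeriv (pt : closedBall (0 : EuclideanSpace ℝ (Fin 4)) 1)
      (mfderiv 𝓘(ℝ, ℝ) (𝓡∂ 4) (tubeLongitudePt b ρ ∘ circlePt) t (1 : ℝ)) =
      (1 : ℝ) • longIso b ρ (coreVelocityAmb t) :=
    congrArg (fun L : ℝ →L[ℝ] EuclideanSpace ℝ (Fin 4) => L 1) h3
  rw [one_smul, longIso_coreVelocityAmb b h0 h1.le] at h4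
  exact ((closedBallCoeDeriv (pt : closedBall (0 : EuclideanSpace ℝ (Fin 4)) 1)).symm_apply_apply _).symm.trans
    (congrArg (closedBallCoeDeriv (pt : closedBall (0 : EuclideanSpace ℝ (Fin 4)) 1)).symm h4)

section Knot

variable {W : Type*} [TopologicalSpace W] [T2Space W] [ChartedSpace (EuclideanHalfSpace 4) W]
  [IsManifold (𝓡∂ 4) ∞ W]

/-- **The `h̄`-image of the `ρ`-longitude is a smooth embedding `𝕊¹ → W`** (immersion `𝕊¹ → T` followed
by the partial diffeomorphism `h̄`; closed embedding of the compact circle). [folklore] -/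
theorem isSmoothEmbedding_longitude (f : HandleAttachingMap 3 2 W) (b : Bool) {ρ : ℝ} (h0 : 0 ≤ ρ)
    (h1 : ρ < 1) :
    Manifold.IsSmoothEmbedding (𝓡 1) (𝓡∂ 4) ∞ fun θ => f.toFun (tubeLongitudePt b ρ θ) := by
  have ho : Topology.IsOpenEmbedding f.toFun := ⟨f.isSmoothEmbedding.isEmbedding, f.isOpen_range⟩
  haveI : Nonempty ↥(handleTube 3 2) := ⟨coreTubePt (circlePt 0)⟩
  set Φ := ho.toOpenPartialHomeomorph f.toFun with hΦ
  have hsrc : Φ.source = univ := ho.toOpenPartialHomeomorph_source _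
  have hcoe : ⇑Φ = f.toFun := ho.toOpenPartialHomeomorph_apply _
  have hΦsm : ContMDiffOn (𝓡∂ 4) (𝓡∂ 4) ∞ Φ Φ.source := by
    rw [hcoe]; exact f.isSmoothEmbedding.contMDiff.contMDiffOn
  have hΦ'sm : ContMDiffOn (𝓡∂ 4) (𝓡∂ 4) ∞ Φ.symm Φ.target := by
    rw [ho.toOpenPartialHomeomorph_target]
    exact contMDiffOn_symm_of_isSmoothEmbedding f.isSmoothEmbedding ho
  have hemb := isSmoothEmbedding_tubeLongitudePt b h0 h1
  have himm := hemb.isImmersion.openPartialHomeomorph_comp Φ hΦsm hΦ'sm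
    (fun θ => by rw [hsrc]; exact mem_univ _)
  rw [hcoe] at himm
  have hinj : Injective fun θ => f.toFun (tubeLongitudePt b ρ θ) :=
    f.isSmoothEmbedding.isEmbedding.injective.comp hemb.isEmbedding.injective
  have hcont : Continuous fun θ => f.toFun (tubeLongitudePt b ρ θ) :=
    f.continuous.comp hemb.contMDiff.continuous
  exact ⟨himm, (hcont.isClosedEmbedding hinj).isEmbedding⟩

/-- **The `h̄`-image of the `ρ`-longitude is a knot in `∂W`** (`0 ≤ ρ < 1`). [folklore] -/
theorem isBoundaryKnot_longitude (f : HandleAttachingMap 3 2 W) (b : Bool) {ρ : ℝ} (h0 : 0 ≤ ρ)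
    (h1 : ρ < 1) : IsBoundaryKnot fun θ => f.toFun (tubeLongitudePt b ρ θ) :=
  ⟨isSmoothEmbedding_longitude f b h0 h1, fun θ => f.isBoundaryPoint _ (by
    rw [coe_coe_tubeLongitudePt b (by nlinarith) θ]; exact norm_tubeLongitudeVec b (by nlinarith) θ)⟩

omit [T2Space W] [IsManifold (𝓡∂ 4) ∞ W] in
/-- **The velocity of the `h̄`-image of the `ρ`-longitude is `dh̄ (Dι⁻¹ (2π V))`.** [folklore] -/
theorem knotVelocity_longitude (f : HandleAttachingMap 3 2 W) (b : Bool) {ρ : ℝ} (h0 : 0 ≤ ρ)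
    (h1 : ρ < 1) (t : ℝ) :
    knotVelocity (fun θ => f.toFun (tubeLongitudePt b ρ θ)) t =
      mfderiv (𝓡∂ 4) (𝓡∂ 4) f.toFun (tubeLongitudePt b ρ (circlePt t))
        ((closedBallCoeDeriv ((tubeLongitudePt b ρ (circlePt t) : ↥(handleTube 3 2)) :
          closedBall (0 : EuclideanSpace ℝ (Fin 4)) 1)).symm
          ((2 * Real.pi) • WithLp.toLp 2 (longVelVec (slideSign b) ρ
            (((circlePt t : sphere (0 : EuclideanSpace ℝ (Fin 2)) 1) : EuclideanSpace ℝ (Fin 2)) 0)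
            (((circlePt t : sphere (0 : EuclideanSpace ℝ (Fin 2)) 1) : EuclideanSpace ℝ (Fin 2)) 1)))) := by
  have hc : MDifferentiableAt 𝓘(ℝ, ℝ) (𝓡∂ 4) (tubeLongitudePt b ρ ∘ circlePt) t :=
    ((contMDiff_tubeLongitudePt b h0 h1 _).comp t contMDiff_circlePt.contMDiffAt).mdifferentiableAt (by simp)
  unfold knotVelocity
  rw [show (fun θ => f.toFun (tubeLongitudePt b ρ θ)) ∘ circlePt = f.toFun ∘ (tubeLongitudePt b ρ ∘ circlePt)
    from rfl, mfderiv_comp t (mdifferentiableAt_handleAttachingMap f _) hc,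
    ← mfderiv_tubeLongitudePt_circlePt b h0 h1 t]
  rfl

/-! ### §3 Push-forwards of sphere-tangent vectors by an attaching map are tangent to `∂W` -/

omit [T2Space W] in
/-- **`dh̄ (Dι⁻¹ X)` is tangent to `∂W`** for a sphere point `y ∈ T` (`‖y‖ = 1`) and `X ⊥ y`: `h̄` maps the
sphere part of `T` to `∂W`, and `Dι⁻¹ X` is tangent to `∂D⁴` (`(Dι⁻¹ X)₀ = −⟪y, X⟫ = 0`).
[cite: Kosinski1993, VI §6] -/
theorem mfderiv_handleAttachingMap_apply_zero (f : HandleAttachingMap 3 2 W) {y : ↥(handleTube 3 2)}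
    (hy : ‖((y : closedBall (0 : EuclideanSpace ℝ (Fin 4)) 1) : EuclideanSpace ℝ (Fin 4))‖ = 1)
    {X : EuclideanSpace ℝ (Fin 4)}
    (hX : ⟪((y : closedBall (0 : EuclideanSpace ℝ (Fin 4)) 1) : EuclideanSpace ℝ (Fin 4)), X⟫ = 0) :
    mfderiv (𝓡∂ 4) (𝓡∂ 4) f.toFun y
      ((closedBallCoeDeriv (y : closedBall (0 : EuclideanSpace ℝ (Fin 4)) 1)).symm X) ∈
        boundaryTangentSpace := by
  have hb : ∀ z : ↥(handleTube 3 2), (𝓡∂ 4).IsBoundaryPoint z ↔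
      ‖((z : closedBall (0 : EuclideanSpace ℝ (Fin 4)) 1) : EuclideanSpace ℝ (Fin 4))‖ = 1 := by
    intro z
    change z ∈ (𝓡∂ 4).boundary ↥(handleTube 3 2) ↔ _
    rw [mem_boundary_opens_iff (handleTube 3 2) z]
    change (z : closedBall (0 : EuclideanSpace ℝ (Fin 4)) 1) ∈ (𝓡∂ (3 + 1)).boundary
      (closedBall (0 : EuclideanSpace ℝ (Fin (3 + 1))) 1) ↔ _
    rw [boundary_closedBall]
    rfl
  have hv : ((closedBallCoeDeriv (y : closedBall (0 : EuclideanSpace ℝ (Fin 4)) 1)).symm X) 0 = 0 := by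
    rw [closedBallCoeDeriv_symm_apply_zero 3 hy X, hX, neg_zero]
  exact (mem_boundaryTangentSpace_iff _).2 (mfderiv_apply_zero_of_isBoundaryPoint
    (mdifferentiableAt_handleAttachingMap f y) ((hb y).2 hy)
    (Filter.Eventually.of_forall fun z hz => f.isBoundaryPoint z ((hb z).1 hz)) hv)

end Knot

/-! ### §4 Registered helper -/

/-- **Registered helper `helper_belt_longitudeKnot` (node T3c-1 of NF6 `stub_steinRealisation`, stage
(3a), wave 3, lead c5): for every attaching map `h̄ : T → W` of a 2-handle, every direction flag `b` and
radius `0 ≤ ρ < 1`, the `h̄`-image of the `ρ`-longitude `θ ↦ (√(1-ρ²) θ₀, ∓√(1-ρ²) θ₁, ρ θ₀, ρ θ₁)` of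
the attaching circle is a knot in `∂W` whose velocity is `dh̄ (Dι⁻¹ (2π V))`,
`V = (−√(1-ρ²) θ₁, ∓√(1-ρ²) θ₀, −ρ θ₁, ρ θ₀)`.** [cite: Kosinski1993, VI §6] -/
theorem helper_belt_longitudeKnot :
    ∀ {W : Type} [TopologicalSpace W] [T2Space W] [ChartedSpace (EuclideanHalfSpace 4) W]
      [IsManifold (𝓡∂ 4) ∞ W] (f : Literature.Topology.FourManifolds.HandleAttachingMap 3 2 W)
      (b : Bool) (ρ : ℝ), 0 ≤ ρ → ρ < 1 →
      Literature.Geometry.Symplectic.IsBoundaryKnot (fun θ => f.toFun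
        (Summit.SmoothPoincare4.SmoothPoincare4.Theorems.AcyclicBisectionExists.ModpBraidOrbits.tubeLongitudePt b ρ θ)) ∧
      ∀ t : ℝ, Literature.Geometry.Symplectic.knotVelocity (fun θ => f.toFun
        (Summit.SmoothPoincare4.SmoothPoincare4.Theorems.AcyclicBisectionExists.ModpBraidOrbits.tubeLongitudePt b ρ θ)) t =
        mfderiv (𝓡∂ 4) (𝓡∂ 4) f.toFun
          (Summit.SmoothPoincare4.SmoothPoincare4.Theorems.AcyclicBisectionExists.ModpBraidOrbits.tubeLongitudePt b ρ
            (Literature.Topology.FourManifolds.circlePt t))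
          ((Literature.Topology.FourManifolds.closedBallCoeDeriv
            ((Summit.SmoothPoincare4.SmoothPoincare4.Theorems.AcyclicBisectionExists.ModpBraidOrbits.tubeLongitudePt b ρ
              (Literature.Topology.FourManifolds.circlePt t) : ↥(Literature.Topology.FourManifolds.handleTube 3 2)) :
              Metric.closedBall (0 : EuclideanSpace ℝ (Fin 4)) 1)).symm
            ((2 * Real.pi) • WithLp.toLp 2
              ![-(Real.sqrt (1 - ρ ^ 2) * ((Literature.Topology.FourManifolds.circlePt t :
                  Metric.sphere (0 : EuclideanSpace ℝ (Fin 2)) 1) : EuclideanSpace ℝ (Fin 2)) 1),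
                (if b then -1 else 1) * Real.sqrt (1 - ρ ^ 2) * ((Literature.Topology.FourManifolds.circlePt t :
                  Metric.sphere (0 : EuclideanSpace ℝ (Fin 2)) 1) : EuclideanSpace ℝ (Fin 2)) 0,
                -(ρ * ((Literature.Topology.FourManifolds.circlePt t :
                  Metric.sphere (0 : EuclideanSpace ℝ (Fin 2)) 1) : EuclideanSpace ℝ (Fin 2)) 1),
                ρ * ((Literature.Topology.FourManifolds.circlePt t :
                  Metric.sphere (0 : EuclideanSpace ℝ (Fin 2)) 1) : EuclideanSpace ℝ (Fin 2)) 0])) := by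
  intro W _ _ _ _ f b ρ h0 h1
  exact ⟨isBoundaryKnot_longitude f b h0 h1, fun t => knotVelocity_longitude f b h0 h1 t⟩

end Summit.SmoothPoincare4.SmoothPoincare4.Theorems.AcyclicBisectionExists.ModpBraidOrbits

end
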